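import Literature.AlgebraicGeometry.Resolution.H0ZeroDimensionalSubscheme
import Literature.AlgebraicGeometry.Resolution.LocalColengthAtPoint
import Literature.AlgebraicGeometry.Resolution.Lipman1969RationalContractionRegime
import Literature.AlgebraicGeometry.Resolution.PrimeDivisorIdealsIntersection
import Literature.AlgebraicGeometry.Resolution.ExceptionalCurveIntersectionSymmetry
import Literature.AlgebraicGeometry.Resolution.ExceptionalPointsFinite
import Literature.AlgebraicGeometry.Resolution.MarkedIdealsArithmetic
import Literature.AlgebraicGeometry.Resolution.BirationalStalkStructureMap
import Mathlib.RingTheory.LocalRing.Length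
import HarnessLib

/-!
# `h⁰(𝒪_{E ∩ F})` and the intersection number `(F·E)` of two distinct exceptional curves (Lipman 1969, (13.1) d))

Topic: `Literature/AlgebraicGeometry/Resolution`.  PROVED, fact-free, definition-free.  J. Lipman, *Rational
singularities, with applications to algebraic surfaces and unique factorization*, Publ. Math. IHÉS 36 (1969), Prop.
(13.1) d) (p. 223): "`(F·E) = χ(E) + χ(F) − χ(E+F) = (E·F)`" for curves `E`, `F` with exceptional support, `E + F`
the curve with ideal `𝒪(−E)𝒪(−F)`; in the proof one reads `χ(E) + χ(F) − χ(E ∪ F) = χ(𝒪_{E ∩ F}) = h⁰(𝒪_{E∩F})`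
(`0 → 𝒪_{E∪F} → 𝒪_E ⊕ 𝒪_F → 𝒪_{E∩F} → 0`) and `(F·E) = deg_E(𝒪(F)|_E) = h⁰(𝒪_{E∩F})` for distinct integral `E`,
`F` (the local equation of `F` restricted to `E`).  This file assembles the DISTINCT-curves case `η ≠ η′` of the
tree's `h⁰`-form named fact `Lipman1969_13_1_d_rat` (`Resolution/Lipman1969IntersectionTheory`) on a resolution
`π : X → Spec T` of a two-dimensional Noetherian local domain with `H¹(X, 𝒪_X) = 0`, from the `χ = h⁰` calculus of
`Resolution/RationalResolutionSubschemeH1Vanishing`, `…H0InclusionExclusion`, `…PrimeDivisorIdealsIntersection`,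
`…H0ZeroDimensionalSubscheme`, `…LocalColengthAtPoint` and the local intersection theory of
`Resolution/ExceptionalCurveIntersectionSymmetry` (Fulton, Thm. 2.4, Case 1):

* §1 `length_quotient_stalkIdeal_sup_eq_ord` — `ℓ(𝒪_{X,w}/(𝔭_E + 𝓘_{F,w})) = ord_{𝒪_{X,w}/𝔭_E}(t̄_F)`;
* §2 `finite_closure_inter_closure_of_height_le_one`, `isClosed_singleton_of_mem_closure_inter`,
  `coe_support_primeDivisorIdeal_sup` — `E ∩ F` is a finite set of closed points containing `supp(𝓘_E + 𝓘_F)`;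
* §3 `finrank_residueField_eq_residueDegree`, `length_residueField_eq_residueDegree` — through the local
  homomorphism `T → 𝒪_{X,w}` (`w` over the closed point), `[κ(w) : κ(𝔪)] = π.residueDegree w`;
* §4 **`toNat_h0_sup_eq_excCurveDegree`** — `h⁰(𝒪_{E∩F}) = (F·E)` (`h0 π (𝓘_η ⊔ 𝓘_{η′})` finite and equal to
  `excCurveDegree π [E_{η′}] η`); **`excCurveDegree_primeDivisor_eq_h0_of_ne`** — Prop. (13.1) d) for `η ≠ η′`
  in `h⁰`-lengths given `H¹(X, 𝒪_X) = 0`; **`Lipman1969_13_1_d_rat_of_ne`** — the `η ≠ η′` instances of the named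
  fact `Lipman1969_13_1_d_rat`, given Prop. (1.2) 2) (`Lipman1969_1_2`).

What is NOT here: the self-intersection case `η = η′` of `Lipman1969_13_1_d_rat` (`(E·E) = 2h⁰(E) − h⁰(2E)`: the
degree of the conormal sheaf `𝓘_E/𝓘_E²`, Riemann–Roch on `E`), and (13.1) b).

## References
* J. Lipman, Publ. Math. IHÉS 36 (1969), Prop. (13.1) d) and its proof (p. 223), §10 (p. 212), Prop. (1.2) (p. 199). [Lipman1969]
* W. Fulton, *Intersection Theory* (2nd ed. 1998), Thm. 2.4 (Case 1, p. 36), App. A.1 (Lemmas A.1.2–A.1.3). [Fulton1998]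
* The Stacks Project, Tag 0BA8. [StacksProject]
-/

noncomputable section

open CategoryTheory AlgebraicGeometry TopologicalSpace IsLocalRing Order
open Literature.AlgebraicGeometry.Morphisms Literature.AlgebraicGeometry.Motives
open Scheme.IdealSheafData

universe u

namespace Literature.AlgebraicGeometry.Resolution

/-! ## §1 The local term: `ℓ(𝒪_{X,w}/(𝓘_E + 𝓘_F)_w) = ord_{𝒪_{X,w}/𝔭_E}(t̄_F)` -/

section LocalTerm

variable {X : Scheme.{u}}

/-- **`ℓ_{𝒪_{X,w}}(𝒪_{X,w}/(𝓘_E + 𝓘_F)_w) = ord_{𝒪_{X,w}/𝔭_E}(t̄_F)`**: at a point `w` of `E = cl{η}`, for `F = V(𝓘_F)`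
an effective Cartier divisor with local equation `t_F` at `w` (`CartierDivisor.cartierGen`), the colength of
`(𝓘_E + 𝓘_F)_w = 𝔭_η + (t_F)` is Fulton's `ℓ(A/(𝔭 + (a))) = ord_{A/𝔭}(ā)` (Thm. 2.4, Case 1 of the proof).
[cite: Fulton1998, Theorem 2.4 (Case 1 of the proof, p. 36)] -/
theorem length_quotient_stalkIdeal_sup_eq_ord {η w : X} (h : η ⤳ w) (I : X.IdealSheafData)
    (hI : IsEffectiveCartier I) :
    Module.length (X.presheaf.stalk w) (X.presheaf.stalk w ⧸ stalkIdeal (primeDivisorIdeal η ⊔ I) w) =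
      Ring.ord (X.presheaf.stalk w ⧸ primeOfSpecializes h)
        (Ideal.Quotient.mk _ (X.presheaf.germ (CartierDivisor.cartierChart I hI w : X.Opens) w
          (CartierDivisor.mem_cartierChart I hI w) (CartierDivisor.cartierGen I hI w))) := by
  set A := X.presheaf.stalk w
  set t := X.presheaf.germ (CartierDivisor.cartierChart I hI w : X.Opens) w
    (CartierDivisor.mem_cartierChart I hI w) (CartierDivisor.cartierGen I hI w) with ht
  set 𝔭 : Ideal A := primeOfSpecializes h with h𝔭
  -- `(𝓘_E + 𝓘_F)_w = 𝔭 ⊔ (t)`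
  have hsup : stalkIdeal (primeDivisorIdeal η ⊔ I) w = 𝔭 ⊔ Ideal.span {t} := by
    rw [stalkIdeal_sup, stalkIdeal_primeDivisorIdeal h, span_germ_cartierGen I hI w]
  rw [hsup]
  -- `ord_{A/𝔭}(t̄) = ℓ_{A/𝔭}((A/𝔭)/(t̄)) = ℓ_A((A/𝔭)/(t̄)) = ℓ_A(A/(𝔭 ⊔ (t)))`
  unfold Ring.ord
  have hspan : Ideal.span {Ideal.Quotient.mk 𝔭 t} = (Ideal.span {t}).map (Ideal.Quotient.mkₐ A 𝔭) := by
    rw [Ideal.map_span, Set.image_singleton]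
    rfl
  rw [hspan, ← Module.length_eq_of_surjective (S := A) (R := A ⧸ 𝔭)
    (M := (A ⧸ 𝔭) ⧸ (Ideal.span {t}).map (Ideal.Quotient.mkₐ A 𝔭)) Ideal.Quotient.mk_surjective]
  exact ((DoubleQuot.quotQuotEquivQuotSupₐ A 𝔭 (Ideal.span {t})).toLinearEquiv.length_eq).symm

end LocalTerm

/-! ## §2 Two distinct exceptional curves: finiteness and support of `E ∩ F` -/

section Finite

/-- In the specialisation order of a scheme, a proper specialisation is strictly smaller. [folklore] -/
private theorem lt_of_specializes_of_ne' {X : Scheme.{u}} {x y : X} (h : y ⤳ x) (hne : x ≠ y) : x < y :=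
  ⟨Scheme.le_iff_specializes.2 h, fun h' => hne ((Scheme.le_iff_specializes.1 h').antisymm h).eq⟩

/-- `(1 : ℕ∞) + 1 ≤ 1` is false. [folklore] -/
private theorem not_one_add_one_le_one' : ¬ ((1 : ℕ∞) + 1 ≤ 1) := by decide

/-- **Two distinct points of height `≤ 1` of a Noetherian scheme have finitely many common specialisations**
(every point of `cl{η} ∩ cl{η′}` is a maximal point of it, and a closed set has finitely many maximal points).
Literature home of the Summits-side `…NoZeno.ExcCount.finite_closure_inter_closure_of_height_le_one`.
[cite: StacksProject, Tag 0BA8] -/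
theorem finite_closure_inter_closure_of_height_le_one {X : Scheme.{u}} [IsNoetherian X] {η η' : X}
    (hη : Order.height η ≤ 1) (hη' : Order.height η' ≤ 1) (hne : η ≠ η') :
    (closure ({η} : Set X) ∩ closure {η'}).Finite := by
  have hZc : IsClosed (closure ({η} : Set X) ∩ closure {η'}) := isClosed_closure.inter isClosed_closure
  refine (maxPoints_finite hZc).subset fun z hz => ?_
  refine mem_maxPoints_iff.2 ⟨hz, fun w hw hwz => ?_⟩
  by_contra hwne
  have hzw : z < w := lt_of_specializes_of_ne' hwz (fun h => hwne h.symm)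
  have hηw : η ⤳ w := specializes_iff_mem_closure.2 hw.1
  have hη'w : η' ⤳ w := specializes_iff_mem_closure.2 hw.2
  have h1 : Order.height z + 1 ≤ Order.height w := Order.height_add_one_le hzw
  have h1' : (1 : ℕ∞) + 1 ≤ Order.height w + 1 := by
    gcongr
    exact le_trans le_add_self h1
  by_cases hwη : w = η
  · subst hwη
    have hlt : w < η' := lt_of_specializes_of_ne' hη'w hne
    have h2 : Order.height w + 1 ≤ Order.height η' := Order.height_add_one_le hlt
    exact not_one_add_one_le_one' (h1'.trans (h2.trans hη'))
  · have hlt : w < η := lt_of_specializes_of_ne' hηw hwη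
    have h2 : Order.height w + 1 ≤ Order.height η := Order.height_add_one_le hlt
    exact not_one_add_one_le_one' (h1'.trans (h2.trans hη))

/-- A point of height `0` in the specialisation order of a scheme is a closed point. [folklore] -/
private theorem isClosed_singleton_of_height_eq_zero {X : Scheme.{u}} {x : X} (hx : Order.height x = 0) :
    IsClosed ({x} : Set X) := by
  rw [← closure_eq_iff_isClosed]
  refine (Set.Subset.antisymm ?_ subset_closure)
  intro y hy
  have hxy : x ⤳ y := specializes_iff_mem_closure.2 hy
  by_contra hne
  have hlt : y < x := lt_of_specializes_of_ne' hxy hne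
  have h := Order.height_add_one_le hlt
  rw [hx] at h
  exact absurd h (by simp)

/-- **A common point of two distinct curves of height `≤ 1` is a closed point** (it is not `η`, and below `η`
there is room for height `0` only). [cite: StacksProject, Tag 0BA8] -/
theorem isClosed_singleton_of_mem_closure_inter {X : Scheme.{u}} {η η' w : X}
    (hη : Order.height η ≤ 1) (hη' : Order.height η' ≤ 1) (hne : η ≠ η')
    (hw : w ∈ closure ({η} : Set X) ∩ closure {η'}) : IsClosed ({w} : Set X) := by
  apply isClosed_singleton_of_height_eq_zero
  have hηw : η ⤳ w := specializes_iff_mem_closure.2 hw.1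
  have hη'w : η' ⤳ w := specializes_iff_mem_closure.2 hw.2
  by_cases hwη : w = η
  · subst hwη
    have hlt : w < η' := lt_of_specializes_of_ne' hη'w hne
    have h2 : Order.height w + 1 ≤ Order.height η' := Order.height_add_one_le hlt
    have h3 : Order.height w + 1 ≤ 1 := h2.trans hη'
    by_contra h0
    exact not_one_add_one_le_one' (le_trans (by gcongr; exact Order.one_le_iff_ne_zero.mpr h0) h3)
  · have hlt : w < η := lt_of_specializes_of_ne' hηw hwη
    have h2 : Order.height w + 1 ≤ Order.height η := Order.height_add_one_le hlt
    have h3 : Order.height w + 1 ≤ 1 := h2.trans hη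
    by_contra h0
    exact not_one_add_one_le_one' (le_trans (by gcongr; exact Order.one_le_iff_ne_zero.mpr h0) h3)

/-- The support of `𝓘_E + 𝓘_F` lies in `E ∩ F`. [cite: Lipman1969, Section 13 (p. 223)] -/
theorem coe_support_primeDivisorIdeal_sup {X : Scheme.{u}} (η η' : X) :
    ((primeDivisorIdeal η ⊔ primeDivisorIdeal η').support : Set X) ⊆ closure ({η} : Set X) ∩ closure {η'} := by
  intro x hx
  have h1 : x ∈ (primeDivisorIdeal η).support :=
    Scheme.IdealSheafData.support_antitone le_sup_left hx
  have h2 : x ∈ (primeDivisorIdeal η').support :=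
    Scheme.IdealSheafData.support_antitone le_sup_right hx
  rw [← SetLike.mem_coe, coe_support_primeDivisorIdeal] at h1 h2
  exact ⟨h1, h2⟩

end Finite

/-! ## §3 The residue degree `[κ(w) : κ(𝔪)]` through `T → 𝒪_{X,w}` is `π.residueDegree w` -/

section ResidueDegree

variable {T : Type u} [CommRing T] [IsLocalRing T] {X : Scheme.{u}} (π : X ⟶ Spec (.of T))

/-- For the local base `T`, `T → 𝒪_{Spec T, 𝔪}` (the localisation at the maximal ideal) is onto. [folklore] -/
private theorem algebraMap_stalk_closedPoint_surjective {y : Spec (.of T)} (hy : y = closedPoint T) :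
    Function.Surjective (algebraMap T ((Spec (.of T)).presheaf.stalk y)) := by
  subst hy
  haveI : IsLocalization.AtPrime ((Spec (.of T)).presheaf.stalk (closedPoint T)) (closedPoint T).asIdeal :=
    StructureSheaf.IsLocalization.to_stalk T (closedPoint T)
  intro b
  obtain ⟨a, ⟨s, hs⟩, rfl⟩ := IsLocalization.exists_mk'_eq (closedPoint T).asIdeal.primeCompl b
  have hsu : IsUnit s := by
    by_contra h
    exact hs h
  refine ⟨a * hsu.unit⁻¹.val, ?_⟩
  rw [IsLocalization.eq_mk'_iff_mul_eq, ← map_mul, mul_assoc, IsUnit.val_inv_mul, mul_one]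

/-- **`ℓ_{κ(𝔪)}(κ(w)) = [κ(w) : κ(𝔪)] = π.residueDegree w`** for `w` over the closed point of the local base
`Spec T`, the `κ(𝔪)`-structure on `κ(w)` being the one through the local homomorphism `T → 𝒪_{X,w}`
(`T → 𝒪_{Spec T,𝔪} → 𝒪_{X,w}`, and `T → 𝒪_{Spec T,𝔪}` induces an isomorphism of residue fields), provided the
residue degree is positive (i.e. finite). [cite: Fulton1998, Lemma A.1.3] -/
theorem finrank_residueField_eq_residueDegree {w : X} (hw : π.base w = closedPoint T) :
    letI : Algebra T (X.presheaf.stalk w) :=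
      ((X.presheaf.germ ⊤ w trivial).hom.comp (Morphisms.algebraMapΓ π)).toAlgebra
    haveI : IsLocalHom (algebraMap T (X.presheaf.stalk w)) := isLocalHom_germ_algebraMapΓ π hw
    Module.finrank (ResidueField T) (ResidueField (X.presheaf.stalk w)) = π.residueDegree w := by
  -- the three local rings `T → B = 𝒪_{Spec T, π w} → S = 𝒪_{X,w}`
  set B := (Spec (.of T)).presheaf.stalk (π.base w) with hB
  set S := X.presheaf.stalk w with hS
  letI algTS : Algebra T S := ((X.presheaf.germ ⊤ w trivial).hom.comp (Morphisms.algebraMapΓ π)).toAlgebra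
  haveI : IsLocalHom (algebraMap T S) := isLocalHom_germ_algebraMapΓ π hw
  letI algTB : Algebra T B := StructureSheaf.stalkAlgebra T (π.base w)
  letI algBS : Algebra B S := (π.stalkMap w).hom.toAlgebra
  haveI : IsLocalHom (algebraMap B S) := inferInstanceAs (IsLocalHom (π.stalkMap w).hom)
  haveI : IsLocalization.AtPrime B (π.base w).asIdeal := StructureSheaf.IsLocalization.to_stalk T (π.base w)
  haveI : IsLocalHom (algebraMap T B) := by
    refine ⟨fun t ht => ?_⟩
    rw [IsLocalization.AtPrime.isUnit_to_map_iff B (π.base w).asIdeal] at ht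
    have ht' : t ∉ (π.base w).asIdeal := ht
    rw [hw] at ht'
    by_contra hnu
    exact ht' hnu
  have htower : IsScalarTower T B S := IsScalarTower.of_algebraMap_eq fun t => by
    change (X.presheaf.germ ⊤ w trivial).hom (Morphisms.algebraMapΓ π t) = (π.stalkMap w).hom (algebraMap T B t)
    rw [germ_algebraMapΓ_eq_stalkMap_germ, germ_top_ΓSpecIso_inv_eq_algebraMap]
  -- `κ(T) → κ(B)` is bijective
  have hsurjTB : Function.Surjective (algebraMap T B) := algebraMap_stalk_closedPoint_surjective hw
  have hbij : Function.Bijective (algebraMap (ResidueField T) (ResidueField B)) := by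
    refine ⟨RingHom.injective _, fun b => ?_⟩
    obtain ⟨b', rfl⟩ := residue_surjective b
    obtain ⟨t, rfl⟩ := hsurjTB b'
    exact ⟨residue T t, (ResidueField.algebraMap_residue t)⟩
  -- `finrank_{κ(T)} κ(S) = finrank_{κ(B)} κ(S)`
  have h1 : Module.finrank (ResidueField T) (ResidueField S) = Module.finrank (ResidueField B) (ResidueField S) := by
    refine Algebra.finrank_eq_of_equiv_equiv (RingEquiv.ofBijective _ hbij) (RingEquiv.refl _) ?_
    apply Ideal.Quotient.ringHom_ext
    ext t
    change algebraMap (ResidueField B) (ResidueField S) (algebraMap (ResidueField T) (ResidueField B) (residue T t)) =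
      algebraMap (ResidueField T) (ResidueField S) (residue T t)
    rw [ResidueField.algebraMap_residue, ResidueField.algebraMap_residue, ResidueField.algebraMap_residue,
      ← IsScalarTower.algebraMap_apply]
  -- `finrank_{κ(B)} κ(S) = π.residueDegree w` (same algebra map `κ(π w) → κ(w)`)
  have h2 : Module.finrank (ResidueField B) (ResidueField S) = π.residueDegree w := by
    letI algR : Algebra ((Spec (.of T)).residueField (π.base w)) (X.residueField w) :=
      (π.residueFieldMap w).hom.toAlgebra
    change _ = Module.finrank ((Spec (.of T)).residueField (π.base w)) (X.residueField w)
    refine Algebra.finrank_eq_of_equiv_equiv (RingEquiv.refl _) (RingEquiv.refl _) ?_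
    apply Ideal.Quotient.ringHom_ext
    ext b
    rfl
  rw [h1, h2]

/-- **`ℓ_{κ(𝔪)}(κ(w)) = π.residueDegree w`** for `w` over the closed point, as soon as `κ(w)` has finite length
(equivalently finite dimension) over `κ(𝔪)` through `T → 𝒪_{X,w}`. [cite: Fulton1998, Lemma A.1.3] -/
theorem length_residueField_eq_residueDegree {w : X} (hw : π.base w = closedPoint T)
    (hfin : letI : Algebra T (X.presheaf.stalk w) :=
        ((X.presheaf.germ ⊤ w trivial).hom.comp (Morphisms.algebraMapΓ π)).toAlgebra
      haveI : IsLocalHom (algebraMap T (X.presheaf.stalk w)) := isLocalHom_germ_algebraMapΓ π hw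
      Module.length (ResidueField T) (ResidueField (X.presheaf.stalk w)) ≠ ⊤) :
    letI : Algebra T (X.presheaf.stalk w) :=
      ((X.presheaf.germ ⊤ w trivial).hom.comp (Morphisms.algebraMapΓ π)).toAlgebra
    haveI : IsLocalHom (algebraMap T (X.presheaf.stalk w)) := isLocalHom_germ_algebraMapΓ π hw
    Module.length (ResidueField T) (ResidueField (X.presheaf.stalk w)) = π.residueDegree w := by
  letI algTS : Algebra T (X.presheaf.stalk w) :=
    ((X.presheaf.germ ⊤ w trivial).hom.comp (Morphisms.algebraMapΓ π)).toAlgebra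
  haveI : IsLocalHom (algebraMap T (X.presheaf.stalk w)) := isLocalHom_germ_algebraMapΓ π hw
  have hfl : IsFiniteLength (ResidueField T) (ResidueField (X.presheaf.stalk w)) :=
    Module.length_ne_top_iff.mp hfin
  rw [isFiniteLength_iff_isNoetherian_isArtinian] at hfl
  haveI : IsNoetherian (ResidueField T) (ResidueField (X.presheaf.stalk w)) := hfl.1
  haveI : Module.Finite (ResidueField T) (ResidueField (X.presheaf.stalk w)) := inferInstance
  rw [Module.length_eq_finrank, finrank_residueField_eq_residueDegree π hw]

end ResidueDegree

/-! ## §4 `h⁰(𝒪_{E∩F}) = (F·E)` for two distinct integral exceptional curves -/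

section Main

variable {T : Type u} [CommRing T] [IsNoetherianRing T] [IsLocalRing T] [IsDomain T]
  {X : Scheme.{u}} [IsIntegral X] [IsLocallyNoetherian X] {π : X ⟶ Spec (.of T)}

omit [IsNoetherianRing T] [IsLocalRing T] [IsDomain T] [IsIntegral X] [IsLocallyNoetherian X] in
/-- Distinct points of height one do not specialise to one another. [folklore] -/
private theorem not_specializes_of_height_eq_one {η η' : X} (hη : Order.height η = 1) (hη' : Order.height η' = 1)
    (hne : η ≠ η') : ¬ η' ⤳ η := by
  intro hsp
  have hlt : η < η' := lt_of_specializes_of_ne' hsp hne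
  have h := Order.height_add_one_le hlt
  rw [hη, hη'] at h
  exact not_one_add_one_le_one' h

omit [IsNoetherianRing T] [IsLocalRing T] [IsDomain T] [IsIntegral X] [IsLocallyNoetherian X] in
/-- `supp(I + J) ⊆ supp I ∩ supp J` pointwise, and conversely: `x ∈ supp(I ⊔ J) ↔ x ∈ supp I ∧ x ∈ supp J`. [folklore] -/
private theorem mem_support_sup_iff (I J : X.IdealSheafData) (x : X) :
    x ∈ (I ⊔ J).support ↔ x ∈ I.support ∧ x ∈ J.support := by
  rw [mem_support_iff_stalkIdeal_le, mem_support_iff_stalkIdeal_le, mem_support_iff_stalkIdeal_le, stalkIdeal_sup,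
    sup_le_iff]

omit [IsDomain T] in
/-- **`h⁰(𝒪_{E ∩ F}) = (F·E)` for two DISTINCT integral exceptional curves `E = E_η`, `F = E_{η′}` of a
desingularization of a two-dimensional Noetherian local domain**: with `𝓘_E + 𝓘_F` the ideal of the
scheme-theoretic intersection, `h0 π (𝓘_η ⊔ 𝓘_{η′})` (an `ℕ∞`, finite here) equals Lipman's intersection number
`(F·E) = excCurveDegree π [F] η = Σ_w ord_w([F]|_E)·[κ(w):κ(𝔪)]`.  Proof: `h⁰ = Σ_{w ∈ E∩F} ℓ_T(Γ(U_w,𝒪)/(𝓘_E+𝓘_F)(U_w))`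
(`H0ZeroDimensionalSubscheme`), each summand is `ℓ_{𝒪_{X,w}}(𝒪_{X,w}/(𝔭_E + (t_F))) · [κ(w):κ(𝔪)]`
(`LocalColengthAtPoint`) `= ord_{𝒪_{X,w}/𝔭_E}(t̄_F) · [κ(w):κ(𝔪)]`, which is the local term of `(F·E)`
(`ExceptionalCurveIntersectionSymmetry.ordAt_pullbackRep_primeDivisor_eq`, Fulton Thm. 2.4 Case 1). This is the
step "`(F·E) = h⁰(𝒪_{E∩F})`" of Lipman's proof of Prop. (13.1) d) (p. 223).
[cite: Lipman1969, Proposition (13.1) d), proof (p. 223)] [cite: Fulton1998, Theorem 2.4 (Case 1 of the proof, p. 36)] -/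
theorem toNat_h0_sup_eq_excCurveDegree (hπ : IsResolution π) {η η' : X}
    (hη : η ∈ excCurvePoints π) (hη' : η' ∈ excCurvePoints π) (hne : η ≠ η')
    (hc' : IsEffectiveCartier (primeDivisorIdeal η')) :
    h0 π (primeDivisorIdeal η ⊔ primeDivisorIdeal η') ≠ ⊤ ∧
      ((h0 π (primeDivisorIdeal η ⊔ primeDivisorIdeal η')).toNat : ℤ) =
        excCurveDegree π (CartierDivisor.ofIsEffectiveCartier (primeDivisorIdeal η') hc') η := by
  classical
  haveI : IsProper π := hπ.isProper
  haveI : IsNoetherian X := by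
    haveI : CompactSpace X := QuasiCompact.compactSpace_of_compactSpace π
    exact {}
  set 𝓙 : X.IdealSheafData := primeDivisorIdeal η ⊔ primeDivisorIdeal η' with h𝓙
  set Zs : Set X := closure ({η} : Set X) ∩ closure {η'} with hZs
  have hZ : Zs.Finite := finite_closure_inter_closure_of_height_le_one hη.2.le hη'.2.le hne
  have hZcl : ∀ p ∈ Zs, IsClosed ({p} : Set X) := fun p hp =>
    isClosed_singleton_of_mem_closure_inter hη.2.le hη'.2.le hne hp
  have hsupp : (𝓙.support : Set X) ⊆ Zs := coe_support_primeDivisorIdeal_sup η η'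
  have hη'η : ¬ η' ⤳ η := not_specializes_of_height_eq_one hη.2 hη'.2 hne
  -- the points of `E ∩ F`
  have hsp : ∀ p : Zs, η ⤳ p.1 := fun p => specializes_iff_mem_closure.2 p.2.1
  have hsp' : ∀ p : Zs, η' ⤳ p.1 := fun p => specializes_iff_mem_closure.2 p.2.2
  have hpη : ∀ p : Zs, p.1 ≠ η := fun p e => hη'η (e ▸ hsp' p)
  have hcl : ∀ p : Zs, π.base p.1 = closedPoint T := fun p => base_eq_closedPoint_of_specializes π hη.1 (hsp p)
  -- `h⁰` as a sum of local colengths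
  obtain ⟨U, hUaff, hU, hU', hsum⟩ := exists_h0_eq_sum_length_quotient π 𝓙 hZ hZcl hsupp
  letI := hZ.fintype
  have honly : ∀ p : Zs, ∀ q ∈ U p.1, q ∈ 𝓙.support → q = p.1 := fun p q hq hqs => hU' p.1 p.2 q (hsupp hqs) hq
  -- the local generator of `𝓘_F` at a point and the local term
  let tF : ∀ w : X, X.presheaf.stalk w := fun w => X.presheaf.germ
    (CartierDivisor.cartierChart _ hc' w : X.Opens) w (CartierDivisor.mem_cartierChart _ hc' w) (CartierDivisor.cartierGen _ hc' w)
  let ordT : Zs → ℕ∞ := fun p =>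
    Ring.ord (X.presheaf.stalk p.1 ⧸ primeOfSpecializes (hsp p)) (Ideal.Quotient.mk _ (tF p.1))
  let κℓ : Zs → ℕ∞ := fun p =>
    letI : Algebra T (X.presheaf.stalk p.1) :=
      ((X.presheaf.germ ⊤ p.1 trivial).hom.comp (Morphisms.algebraMapΓ π)).toAlgebra
    haveI : IsLocalHom (algebraMap T (X.presheaf.stalk p.1)) := isLocalHom_germ_algebraMapΓ π (hcl p)
    Module.length (ResidueField T) (ResidueField (X.presheaf.stalk p.1))
  -- Step A: the summands
  have hA : ∀ p : Zs, Module.length T (Sections π (U p.1) ⧸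
      (𝓙.ideal ⟨U p.1, hUaff p.1 p.2⟩).comap (Sections.equiv π (U p.1)).toRingHom) = ordT p * κℓ p := by
    intro p
    rw [length_quotient_sections_eq_mul π 𝓙 (hUaff p.1 p.2) (hU p.1 p.2) (hcl p) (honly p),
      h𝓙, length_quotient_stalkIdeal_sup_eq_ord (hsp p) (primeDivisorIdeal η') hc']
  have hsumA : h0 π 𝓙 = ∑ p : Zs, ordT p * κℓ p := by
    rw [hsum]
    exact Fintype.sum_congr _ _ fun p => hA p
  -- Step B: `h⁰` is finite
  have hfin : h0 π 𝓙 ≠ ⊤ := by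
    refine h0_ne_top_of_base_eq_closedPoint π 𝓙 fun x => ?_
    have hx : 𝓙.subschemeι.base x ∈ (𝓙.support : Set X) :=
      (Set.ext_iff.mp (Scheme.IdealSheafData.range_subschemeι (I := 𝓙)) _).mp (Set.mem_range_self x)
    exact base_eq_closedPoint_of_specializes π hη.1 (specializes_iff_mem_closure.2 (hsupp hx).1)
  -- Step C: termwise comparison with the natural numbers `n p = ord · [κ(p):κ(𝔪)]`
  let n : Zs → ℕ := fun p => (ordT p).toNat * π.residueDegree p.1
  have hterm : ∀ p : Zs, ordT p * κℓ p = (n p : ℕ∞) := by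
    intro p
    have hle : ordT p * κℓ p ≤ h0 π 𝓙 := by
      rw [hsumA]
      exact Finset.single_le_sum (f := fun p => ordT p * κℓ p) (fun i _ => bot_le) (Finset.mem_univ p)
    have hne_top : ordT p * κℓ p ≠ ⊤ := ne_top_of_le_ne_top hfin hle
    by_cases h0p : ordT p = 0
    · simp only [n, h0p, zero_mul, ENat.toNat_zero, Nat.cast_zero]
    · have hκ : κℓ p ≠ ⊤ := fun h => hne_top (WithTop.mul_eq_top_iff.mpr (Or.inl ⟨h0p, h⟩))
      have hκpos : κℓ p ≠ 0 := by
        letI : Algebra T (X.presheaf.stalk p.1) :=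
          ((X.presheaf.germ ⊤ p.1 trivial).hom.comp (Morphisms.algebraMapΓ π)).toAlgebra
        haveI : IsLocalHom (algebraMap T (X.presheaf.stalk p.1)) := isLocalHom_germ_algebraMapΓ π (hcl p)
        change Module.length (ResidueField T) (ResidueField (X.presheaf.stalk p.1)) ≠ 0
        exact Module.length_pos.ne'
      have hord : ordT p ≠ ⊤ := fun h => hne_top (WithTop.mul_eq_top_iff.mpr (Or.inr ⟨h, hκpos⟩))
      have hκeq : κℓ p = π.residueDegree p.1 := length_residueField_eq_residueDegree π (hcl p) hκ
      simp only [n]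
      rw [hκeq, Nat.cast_mul, ENat.coe_toNat hord]
  have hsumN : h0 π 𝓙 = ((∑ p : Zs, n p : ℕ) : ℕ∞) := by
    rw [hsumA, Nat.cast_sum]
    exact Fintype.sum_congr _ _ fun p => hterm p
  refine ⟨hfin, ?_⟩
  rw [hsumN, ENat.toNat_coe, Nat.cast_sum]
  -- Step E: the intersection number as the same sum
  rw [excCurveDegree_eq_finsum_dite π _ η]
  set G : X → ℤ := fun w => if h : η ⤳ w then
      ((CartierDivisor.ofIsEffectiveCartier (primeDivisorIdeal η') hc').pullbackRep
        (ClosedSubvariety.ofPoint X η).ι).ordAt (ClosedSubvariety.ofPointPt η h) * ((π.residueDegree w : ℕ) : ℤ)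
    else 0 with hG
  have hGsupp : Function.support G ⊆ Zs := by
    intro w hw
    rw [Function.mem_support] at hw
    by_cases h : η ⤳ w
    · by_cases h' : η' ⤳ w
      · exact ⟨specializes_iff_mem_closure.1 h, specializes_iff_mem_closure.1 h'⟩
      · exfalso
        apply hw
        rw [hG]
        simp only [dif_pos h, ordAt_pullbackRep_primeDivisor_eq_zero hη'η h h' hc', zero_mul]
    · exfalso
      apply hw
      rw [hG]
      simp only [dif_neg h]
  rw [finsum_eq_sum_of_support_subset_of_finite G hGsupp hZ, Set.Finite.toFinset_eq_toFinset,
    ← Finset.sum_set_coe]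
  refine (Fintype.sum_congr _ _ fun p => ?_).symm
  rw [hG]
  simp only [dif_pos (hsp p), n]
  rw [ordAt_pullbackRep_primeDivisor_eq π hη hη'η (hsp p) (hpη p) hc', Nat.cast_mul]

omit [IsDomain T] [IsIntegral X] [IsLocallyNoetherian X] in
/-- `h⁰(𝒪_{E ∪ F})` is finite for two integral exceptional curves: `V(𝓘_F 𝓘_E)` has support `F ∪ E`, over the closed
point. [cite: Lipman1969, Section 10 (p. 212)] -/
theorem h0_primeDivisorIdeal_mul_ne_top (hπ : IsResolution π) {η η' : X} (hη : η ∈ excCurvePoints π)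
    (hη' : η' ∈ excCurvePoints π) : h0 π (primeDivisorIdeal η' * primeDivisorIdeal η) ≠ ⊤ := by
  haveI : IsProper π := hπ.isProper
  refine h0_ne_top_of_base_eq_closedPoint π _ fun x => ?_
  have hx : (primeDivisorIdeal η' * primeDivisorIdeal η).subschemeι.base x ∈
      ((primeDivisorIdeal η' * primeDivisorIdeal η).support : Set X) :=
    (Set.ext_iff.mp (Scheme.IdealSheafData.range_subschemeι (I := primeDivisorIdeal η' * primeDivisorIdeal η)) _).mp
      (Set.mem_range_self x)
  rw [Scheme.IdealSheafData.support_mul] at hx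
  rcases hx with h | h
  · have h' : (primeDivisorIdeal η' * primeDivisorIdeal η).subschemeι.base x ∈ closure ({η'} : Set X) := by
      rw [← coe_support_primeDivisorIdeal]; exact h
    exact base_eq_closedPoint_of_specializes π hη'.1 (specializes_iff_mem_closure.2 h')
  · have h' : (primeDivisorIdeal η' * primeDivisorIdeal η).subschemeι.base x ∈ closure ({η} : Set X) := by
      rw [← coe_support_primeDivisorIdeal]; exact h
    exact base_eq_closedPoint_of_specializes π hη.1 (specializes_iff_mem_closure.2 h')

/-- **Lipman 1969, Prop. (13.1) d) for two DISTINCT integral exceptional curves, in `h⁰`-lengths, on a resolution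
with `H¹(X, 𝒪_X) = 0`**: `(F·E) = h⁰(E) + h⁰(F) − h⁰(E + F)` with `E + F = V(𝓘_F 𝓘_E)` — i.e.
`excCurveDegree π [E_{η′}] η = h0 𝓘_η + h0 𝓘_{η′} − h0 (𝓘_{η′} 𝓘_η)` for `η ≠ η′` — from `(F·E) = h⁰(𝒪_{E∩F})`
(`toNat_h0_sup_eq_excCurveDegree`), inclusion–exclusion `h⁰(𝓘∩𝓘′) + h⁰(𝓘+𝓘′) = h⁰(𝓘) + h⁰(𝓘′)`
(`IsResolution.h0_inf_add_h0_sup`, where `H¹(X, 𝒪_X) = 0` and `Ȟ² = 0` enter) and `𝓘 ∩ 𝓘′ = 𝓘𝓘′`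
(`IsResolution.primeDivisorIdeal_inf_eq_mul`). The case `η = η′` (`(E·E) = 2h⁰(E) − h⁰(2E)`, conormal degree) is
NOT covered here. [cite: Lipman1969, Proposition (13.1) d) (p. 223)] -/
theorem excCurveDegree_primeDivisor_eq_h0_of_ne (h2 : ringKrullDim T = 2) (hπ : IsResolution π)
    (h1 : HasTrivialCechH1 π) {η η' : X} (hη : η ∈ excCurvePoints π) (hη' : η' ∈ excCurvePoints π)
    (hne : η ≠ η') (hF : IsEffectiveCartier (primeDivisorIdeal η')) :
    excCurveDegree π (CartierDivisor.ofIsEffectiveCartier (primeDivisorIdeal η') hF) η =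
      ((h0 π (primeDivisorIdeal η)).toNat : ℤ) + ((h0 π (primeDivisorIdeal η')).toNat : ℤ) -
        ((h0 π (primeDivisorIdeal η' * primeDivisorIdeal η)).toNat : ℤ) := by
  haveI : IsProper π := hπ.isProper
  obtain ⟨hfin, hsup⟩ := toNat_h0_sup_eq_excCurveDegree hπ hη hη' hne hF
  have hie := hπ.h0_inf_add_h0_sup π h2 h1 (primeDivisorIdeal η) (primeDivisorIdeal η')
  rw [hπ.primeDivisorIdeal_inf_eq_mul h2 hη hη' hne, mul_comm] at hie
  have hE : h0 π (primeDivisorIdeal η) ≠ ⊤ := by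
    simpa only [pow_one] using h0_pow_primeDivisorIdeal_ne_top π hη one_ne_zero
  have hF' : h0 π (primeDivisorIdeal η') ≠ ⊤ := by
    simpa only [pow_one] using h0_pow_primeDivisorIdeal_ne_top π hη' one_ne_zero
  have hEF := h0_primeDivisorIdeal_mul_ne_top hπ hη hη'
  -- pass to natural numbers
  have key : (h0 π (primeDivisorIdeal η' * primeDivisorIdeal η)).toNat +
      (h0 π (primeDivisorIdeal η ⊔ primeDivisorIdeal η')).toNat =
        (h0 π (primeDivisorIdeal η)).toNat + (h0 π (primeDivisorIdeal η')).toNat := by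
    have h := congrArg ENat.toNat hie
    rwa [ENat.toNat_add hEF hfin, ENat.toNat_add hE hF'] at h
  rw [← hsup]
  omega

/-- **Lipman 1969, Prop. (13.1) d) for distinct curves, in the rational regime of the named fact
`Lipman1969_13_1_d_rat`** (`S` normal of dimension `2` with a rational singularity, `π` any desingularization):
the `η ≠ η′` instances of that fact, GIVEN Prop. (1.2) 2) (`H¹(X, 𝒪_X) = 0` for `π`; the named fact
`Lipman1969_1_2`, hypothesis `h12`). [cite: Lipman1969, Proposition (13.1) d) (p. 223)] -/
theorem Lipman1969_13_1_d_rat_of_ne (h12 : Lipman1969_1_2.{u})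
    {S : Type u} [CommRing S] [IsNoetherianRing S] [IsLocalRing S] [IsDomain S] [IsIntegrallyClosed S]
    (hdim : ringKrullDim S = 2) (hrat : HasRationalSingularity S)
    {X : Scheme.{u}} [IsIntegral X] [IsLocallyNoetherian X] (π : X ⟶ Spec (.of S)) (hπ : IsResolution π)
    {η : X} (hη : η ∈ excCurvePoints π) {η' : X} (hη' : η' ∈ excCurvePoints π) (hne : η ≠ η')
    (hF : IsEffectiveCartier (primeDivisorIdeal η')) :
    excCurveDegree π (CartierDivisor.ofIsEffectiveCartier (primeDivisorIdeal η') hF) η =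
      ((h0 π (primeDivisorIdeal η)).toNat : ℤ) + ((h0 π (primeDivisorIdeal η')).toNat : ℤ) -
        ((h0 π (primeDivisorIdeal η' * primeDivisorIdeal η)).toNat : ℤ) :=
  excCurveDegree_primeDivisor_eq_h0_of_ne hdim hπ (h12.hasTrivialCechH1_of_isResolution hdim hrat π hπ)
    hη hη' hne hF

end Main

end Literature.AlgebraicGeometry.Resolution

end
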